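import Mathlib
import Summits.CriticalPhenomena.CardyFormulaZ2.Theorems.CardyMagicRigidityNestingRigidityFusionReduction
import Summits.CriticalPhenomena.CardyFormulaZ2.Theorems.CardyMagicRigidityNestingRigidityFusionCloudLoopSide
import Summits.CriticalPhenomena.CardyFormulaZ2.Theorems.CardyMagicRigidityNestingRigidityGapCrossing
import Literature.Probability.Percolation.FKLoopNestingIntegrable
import HarnessLib

/-!
# Crux `NestingRigidity`, line `ring-cloud-tomography` (r5): the RSW core of the `η`-squeeze —
# tight hugging loops and tied bands are rare on BOTH lattices (stub R5' `stub_fusionTilt`)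

Crux `Summit.CriticalPhenomena.CardyFormulaZ2.Theses.CardyMagicRigidity.NestingRigidity`
(stmt-CriticalPhenomena-4835), line `ring-cloud-tomography`, skeleton r5, stub R5' `stub_fusionTilt`
(the `n ≥ 2` fusion step).  The fusion device "hug a sub-family of discs by a ring at radius
`(1 + η) ×` its circumradius" rests on one percolation estimate: a loop that surrounds a closed disc
touching the hugging circle from inside, while staying inside the slightly larger hugging ball, has to
squeeze through a GATE of width `η ×` radius and still reach macroscopically far — a two-arm event
from a tiny ball, of probability `O(η^c)` UNIFORMLY in the mesh.  This file proves it on both lattice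
ensembles of the crux from the landed gap-crossing bound
(`measure_exists_loop_cross_le_latticeEnsembles`, `…GapCrossing`, p117337; RSW behind it), with no
cited fact and no definition:

* §1 POLE GEOMETRY (deterministic, any unbased loop `u`): if `W(u, ·)` differs at two points of a
  closed ball, the trace meets that ball (winding constancy on convex sets missing the trace,
  `UnbasedLoop.wind_eq_wind_of_disjoint`); if `W(u, q') ≠ 0` the trace leaves `B(p, dist q' p)` for
  every `p` (a loop inside a ball winds around no point outside it); hence THE GATE: `W(u, w + v) ≠ 0`
  and `trace u ⊆ B(w, (1+η)‖v‖)` force the trace to meet `B̄(p, η‖v‖/2)`, `p = w + (1 + η/2) v`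
  (the radial segment from `w + v` to `w + (1+η) v` has winding numbers `≠ 0` and `= 0` at its ends).
* §2 THE TWO-ARM BOUNDS (both lattices, registered vocabulary only): with antipodal anchors
  `W(u, w ± v) ≠ 0` the trace also leaves `B(p, 2‖v‖)`, so
  `P {some loop of X_δ winds around w + v and w − v inside B(w, (1+η)‖v‖)} ≤ C η^c` whenever
  `c₀ δ ≤ η ‖v‖` (`measure_exists_loop_antipodes_le`); with a disc anchor — the gate point `w + v` lies
  in a surrounded closed disc `B̄(x, ρ)` — the trace leaves `B(p, ρ/2)` and the bound is
  `C (η‖v‖/ρ)^c` (`measure_exists_loop_gate_disc_le`, any eccentric hugging ball).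
* §3 THE HUGGING-LOOP BOUND (registered anchor `measure_exists_huggingLoop_le_latticeEnsembles`):
  `P {some loop of X_δ surrounds B̄(z₀, r₀) inside B(z₀, (1+η) r₀)} ≤ C η^c` for `c₀ δ ≤ η r₀`.
* §4 TIED BANDS OF DISC FAMILIES: if antipodal gate points `w ± v` of a hugging ball lie in two discs
  of the pattern `S`, the event "some loop surrounds every disc of `S` inside `B(w, (1+η)‖v‖)`" has
  probability `≤ C η^c` (`measure_exists_tiedLoop_le`); in a hugging WINDOW `B(0, (1+η)‖v‖)` every
  pattern count `N_S`, `S ∋ i, j`, vanishes outside that event, so the tilted pattern moment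
  `tilt E z r ((1+η)‖v‖) u δ` moves by at most `C η^c` when the weights `u_S ∈ [0, 1]` of the tied
  patterns `S ⊇ {i, j}` are changed arbitrarily — uniformly in `δ` (`abs_tilt_sub_tilt_le_of_gates`).

What this does NOT give (see the stub's docstring in the skeleton): an open set of weight vectors.  In a
hugging window the tied weights are INVISIBLE (not free), and outside it the tied band carries the
additive ridge weight `w(Σ_{i∈S} a_i)`; the squeeze localises the obstruction, it does not remove it.
-/

noncomputable section

open MeasureTheory Set Filter Metric
open scoped Real Topology BigOperators ENNReal

namespace Summit.CriticalPhenomena.CardyFormulaZ2.Cruxes.NestingRigidity.RingCloudTomography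

open Literature.Probability.RandomPlanarGeometry Literature.Probability.Percolation
  Literature.Probability.LatticeModels
open Summit.CriticalPhenomena.CardyFormulaZ2.Cruxes.NestingRigidity.PositiveConeWeightDoubling
  (nonemptyParts tilt)

namespace FusionSqueeze

/-! ## §1 Pole geometry of a single loop -/

/-- **Different winding numbers at two points of a closed ball put the trace in the ball**: the
winding number of an unbased loop is constant on a closed ball missed by its trace. -/
theorem nonempty_range_inter_closedBall_of_wind_ne (u : UnbasedLoop ℂ) {p q q' : ℂ} {ρ : ℝ}
    (hq : q ∈ closedBall p ρ) (hq' : q' ∈ closedBall p ρ) (hne : u.wind q ≠ u.wind q') :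
    (u.range ∩ closedBall p ρ).Nonempty := by
  by_contra h
  exact hne (u.wind_eq_wind_of_disjoint
    (Set.disjoint_iff_inter_eq_empty.2 (Set.not_nonempty_iff_eq_empty.1 h)) hq hq')

/-- **A surrounded point anchors the trace far away**: if `W(u, q') ≠ 0` then for every centre `p`
the trace of `u` leaves the open ball `B(p, dist q' p)` (a loop inside a ball winds around no point at
distance `≥` its radius from the centre). -/
theorem nonempty_range_inter_compl_ball_of_wind_ne_zero (u : UnbasedLoop ℂ) (p : ℂ) {q' : ℂ}
    (hq' : u.wind q' ≠ 0) : (u.range ∩ (ball p (dist q' p))ᶜ).Nonempty := by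
  by_contra h
  exact hq' (unbasedLoop_wind_eq_zero_of_subset_ball u (w := p) (ρ := dist q' p)
    (fun x hx ↦ by_contra fun hx' ↦ h ⟨x, hx, hx'⟩) le_rfl)

/-- Norm of a real multiple in `ℂ`. -/
theorem norm_realCast_mul (a : ℝ) (v : ℂ) : ‖(a : ℂ) * v‖ = |a| * ‖v‖ := by
  rw [norm_mul, Complex.norm_real, Real.norm_eq_abs]

/-- **The gate.**  If `u` winds around `w + v` and its trace lies in the hugging ball
`B(w, (1 + η)‖v‖)` (`η ≥ 0`), then the trace meets the closed ball of radius `η‖v‖/2` about the pole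
`p = w + (1 + η/2) v`: the radial segment from `w + v` (where `W ≠ 0`) to `w + (1 + η) v` (where
`W = 0`, the point being at distance `(1+η)‖v‖` from `w`) lies in that ball. -/
theorem nonempty_range_inter_gate (u : UnbasedLoop ℂ) {w v : ℂ} {η : ℝ} (hη : 0 ≤ η)
    (hq : u.wind (w + v) ≠ 0) (hu : u.range ⊆ ball w ((1 + η) * ‖v‖)) :
    (u.range ∩ closedBall (w + ((1 + η / 2 : ℝ) : ℂ) * v) (η / 2 * ‖v‖)).Nonempty := by
  have hstar : u.wind (w + ((1 + η : ℝ) : ℂ) * v) = 0 := by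
    refine unbasedLoop_wind_eq_zero_of_subset_ball u hu ?_
    rw [dist_eq_norm, add_sub_cancel_left, norm_realCast_mul, abs_of_nonneg (by linarith)]
  refine nonempty_range_inter_closedBall_of_wind_ne u ?_ ?_ (hstar.symm ▸ hq)
  · rw [mem_closedBall, dist_eq_norm,
      show w + v - (w + ((1 + η / 2 : ℝ) : ℂ) * v) = ((-(η / 2) : ℝ) : ℂ) * v by push_cast; ring,
      norm_realCast_mul, abs_neg, abs_of_nonneg (by linarith)]
  · rw [mem_closedBall, dist_eq_norm,
      show w + ((1 + η : ℝ) : ℂ) * v - (w + ((1 + η / 2 : ℝ) : ℂ) * v) = ((η / 2 : ℝ) : ℂ) * v by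
        push_cast; ring,
      norm_realCast_mul, abs_of_nonneg (by linarith)]

/-- **Antipodal anchor.**  If `u` also winds around the antipode `w − v`, its trace leaves
`B(p, 2‖v‖)`, `p = w + (1 + η/2) v` (`η ≥ 0`): the antipode is at distance `(2 + η/2)‖v‖` from the
pole. -/
theorem nonempty_range_inter_compl_ball_of_antipode (u : UnbasedLoop ℂ) {w v : ℂ} {η : ℝ}
    (hη : 0 ≤ η) (hq' : u.wind (w - v) ≠ 0) :
    (u.range ∩ (ball (w + ((1 + η / 2 : ℝ) : ℂ) * v) (2 * ‖v‖))ᶜ).Nonempty := by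
  obtain ⟨x, hx, hfar⟩ := nonempty_range_inter_compl_ball_of_wind_ne_zero u
    (w + ((1 + η / 2 : ℝ) : ℂ) * v) hq'
  refine ⟨x, hx, fun hxb ↦ hfar (ball_subset_ball ?_ hxb)⟩
  rw [dist_eq_norm, show w - v - (w + ((1 + η / 2 : ℝ) : ℂ) * v) = ((-(2 + η / 2) : ℝ) : ℂ) * v by
      push_cast; ring,
    norm_realCast_mul, abs_neg, abs_of_nonneg (by linarith)]
  nlinarith [norm_nonneg v]

/-- **A closed disc inside an open ball**: `B̄(x, ρ) ⊆ B(w, R)` with `ρ ≥ 0` forces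
`dist x w + ρ ≤ R` (test the point of the disc radially farthest from `w`). -/
theorem dist_add_le_of_closedBall_subset_ball {x w : ℂ} {ρ R : ℝ} (hρ : 0 ≤ ρ)
    (h : closedBall x ρ ⊆ ball w R) : dist x w + ρ ≤ R := by
  by_cases hxw : x = w
  · subst hxw
    have hz : x + (ρ : ℂ) ∈ closedBall x ρ := by
      rw [mem_closedBall, dist_eq_norm, add_sub_cancel_left, Complex.norm_real, Real.norm_eq_abs,
        abs_of_nonneg hρ]
    have := h hz
    rw [mem_ball, dist_eq_norm, add_sub_cancel_left, Complex.norm_real, Real.norm_eq_abs,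
      abs_of_nonneg hρ] at this
    rw [dist_self]
    linarith
  · have hxp : 0 < ‖x - w‖ := norm_pos_iff.2 (sub_ne_zero.2 hxw)
    have hz : x + ((ρ / ‖x - w‖ : ℝ) : ℂ) * (x - w) ∈ closedBall x ρ := by
      rw [mem_closedBall, dist_eq_norm, add_sub_cancel_left, norm_realCast_mul,
        abs_of_nonneg (div_nonneg hρ hxp.le), div_mul_cancel₀ _ hxp.ne']
    have := h hz
    rw [mem_ball, dist_eq_norm,
      show x + ((ρ / ‖x - w‖ : ℝ) : ℂ) * (x - w) - w = ((1 + ρ / ‖x - w‖ : ℝ) : ℂ) * (x - w) by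
        push_cast; ring,
      norm_realCast_mul, abs_of_nonneg (by positivity), add_mul, one_mul,
      div_mul_cancel₀ _ hxp.ne'] at this
    rw [dist_eq_norm]
    linarith

/-- **The winding interior lies in any ball containing the trace** (pointwise form). -/
theorem dist_lt_of_wind_ne_zero (u : UnbasedLoop ℂ) {w z : ℂ} {R : ℝ} (hu : u.range ⊆ ball w R)
    (hz : u.wind z ≠ 0) : dist z w < R :=
  lt_of_not_ge fun hge ↦ hz (unbasedLoop_wind_eq_zero_of_subset_ball u hu hge)

/-- **Disc anchor.**  If the gate point `w + v` lies in a closed disc `B̄(x, ρ)` surrounded by `u`,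
the trace lies in `B(w, (1+η)‖v‖)` (`η ≥ 0`) and `η‖v‖ ≤ ρ`, then the trace leaves `B(p, ρ/2)`,
`p = w + (1 + η/2) v`: the disc lies in the winding interior, hence in the hugging ball, so
`dist x w ≤ (1+η)‖v‖ − ρ` and the surrounded centre `x` is at distance `≥ ρ − η‖v‖/2 ≥ ρ/2` from
the pole. -/
theorem nonempty_range_inter_compl_ball_of_disc (u : UnbasedLoop ℂ) {w v x : ℂ} {η ρ : ℝ}
    (hη : 0 ≤ η) (hηρ : η * ‖v‖ ≤ ρ) (hx : closedBall x ρ ⊆ {z | u.wind z ≠ 0})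
    (hu : u.range ⊆ ball w ((1 + η) * ‖v‖)) :
    (u.range ∩ (ball (w + ((1 + η / 2 : ℝ) : ℂ) * v) (ρ / 2))ᶜ).Nonempty := by
  have hρ : 0 ≤ ρ := le_trans (mul_nonneg hη (norm_nonneg v)) hηρ
  have hwx : u.wind x ≠ 0 := hx (mem_closedBall_self hρ)
  obtain ⟨y, hy, hfar⟩ := nonempty_range_inter_compl_ball_of_wind_ne_zero u
    (w + ((1 + η / 2 : ℝ) : ℂ) * v) hwx
  refine ⟨y, hy, fun hyb ↦ hfar (ball_subset_ball ?_ hyb)⟩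
  have hsub : closedBall x ρ ⊆ ball w ((1 + η) * ‖v‖) := fun z hz ↦
    mem_ball.2 (dist_lt_of_wind_ne_zero u hu (hx hz))
  have h1 := dist_add_le_of_closedBall_subset_ball hρ hsub
  have h2 : dist (w + ((1 + η / 2 : ℝ) : ℂ) * v) w = (1 + η / 2) * ‖v‖ := by
    rw [dist_eq_norm, add_sub_cancel_left, norm_realCast_mul, abs_of_nonneg (by linarith)]
  have h3 := dist_triangle (w + ((1 + η / 2 : ℝ) : ℂ) * v) x w
  rw [dist_comm _ x] at h3
  linarith

/-! ## §2 The two-arm bounds on both lattice ensembles -/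

/-- `(η/4)^c ≤ η^c` and the like: shrinking the base of a real power with exponent `≥ 0`. -/
theorem rpow_div_le_rpow {η k c : ℝ} (hη : 0 ≤ η) (hk : 1 ≤ k) (hc : 0 ≤ c) :
    (η / k) ^ c ≤ η ^ c :=
  Real.rpow_le_rpow (div_nonneg hη (by linarith)) (div_le_self hη hk) hc

/-- `0 < η‖v‖` forces `0 < η` and `v ≠ 0`. -/
theorem pos_of_mul_norm_pos {η : ℝ} {v : ℂ} (h : 0 < η * ‖v‖) : 0 < η ∧ 0 < ‖v‖ :=
  have hv : 0 < ‖v‖ := lt_of_le_of_ne (norm_nonneg v) fun h0 ↦ by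
    rw [← h0, mul_zero] at h; exact lt_irrefl 0 h
  ⟨pos_of_mul_pos_left h hv.le, hv⟩

/-- **Tight loops through antipodal gates are rare** (both lattices).  For `E ∈ latticeEnsembles`
there are `c, C, c₀ > 0` such that for every centre `w`, every `v`, every `η` and every mesh `δ > 0`
with `c₀ δ ≤ η ‖v‖`, the probability that SOME loop of `X_δ` winds around both `w + v` and `w − v`
while its trace stays inside the hugging ball `B(w, (1 + η)‖v‖)` is at most `C η^c`: such a loop
meets `B̄(p, η‖v‖/2)` and leaves `B(p, 2‖v‖)`, `p = w + (1 + η/2) v` (§1), a gap crossing of ratio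
`η/4` (`measure_exists_loop_cross_le_latticeEnsembles`). -/
theorem measure_exists_loop_antipodes_le : ∀ E ∈ latticeEnsembles, ∃ c C c₀ : ℝ,
    0 < c ∧ 0 < C ∧ 0 < c₀ ∧ ∀ (w v : ℂ) (η δ : ℝ), 0 < δ → c₀ * δ ≤ η * ‖v‖ →
      E.P {ω | ∃ u ∈ (E.X δ ω).loops, u.wind (w + v) ≠ 0 ∧ u.wind (w - v) ≠ 0 ∧
        u.range ⊆ ball w ((1 + η) * ‖v‖)} ≤ ENNReal.ofReal (C * η ^ c) := by
  intro E hE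
  obtain ⟨c, C, c₀, hc, hC, hc₀, hbd⟩ := measure_exists_loop_cross_le_latticeEnsembles E hE
  refine ⟨c, C, 2 * c₀, hc, hC, by positivity, fun w v η δ hδ hηv ↦ ?_⟩
  obtain ⟨hη, hv⟩ := pos_of_mul_norm_pos (lt_of_lt_of_le (by positivity) hηv)
  set p : ℂ := w + ((1 + η / 2 : ℝ) : ℂ) * v with hp
  have hsub : {ω | ∃ u ∈ (E.X δ ω).loops, u.wind (w + v) ≠ 0 ∧ u.wind (w - v) ≠ 0 ∧
      u.range ⊆ ball w ((1 + η) * ‖v‖)} ⊆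
      {ω | ∃ u ∈ (E.X δ ω).loops, (u.range ∩ closedBall p (η / 2 * ‖v‖)).Nonempty ∧
        (u.range ∩ (ball p (2 * ‖v‖))ᶜ).Nonempty} := by
    rintro ω ⟨u, hu, hwp, hwm, hr⟩
    exact ⟨u, hu, nonempty_range_inter_gate u hη.le hwp hr,
      nonempty_range_inter_compl_ball_of_antipode u hη.le hwm⟩
  calc E.P _ ≤ E.P _ := measure_mono hsub
    _ ≤ ENNReal.ofReal (C * (η / 2 * ‖v‖ / (2 * ‖v‖)) ^ c) :=
        hbd p (η / 2 * ‖v‖) (2 * ‖v‖) δ hδ (by linarith) (by positivity)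
    _ ≤ ENNReal.ofReal (C * η ^ c) := by
        refine ENNReal.ofReal_le_ofReal (mul_le_mul_of_nonneg_left ?_ hC.le)
        rw [show η / 2 * ‖v‖ / (2 * ‖v‖) = η / 4 by field_simp; ring]
        exact rpow_div_le_rpow hη.le (by norm_num) hc.le

/-- **Tight loops through a gate in a surrounded disc are rare** (both lattices; the eccentric
hugging ball).  For `E ∈ latticeEnsembles` there are `c, C, c₀ > 0` such that: if the gate point
`w + v` of the hugging ball `B(w, (1+η)‖v‖)` lies in a closed disc `B̄(x, ρ)` with `η‖v‖ ≤ ρ`, then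
for every mesh `δ > 0` with `c₀ δ ≤ η‖v‖` the probability that SOME loop of `X_δ` surrounds
`B̄(x, ρ)` with trace inside `B(w, (1+η)‖v‖)` is at most `C (η‖v‖/ρ)^c` (gate `B̄(p, η‖v‖/2)`, anchor
`B(p, ρ/2)`, §1).  Typical use: `B̄(w, ‖v‖)` the circumscribed disc of a sub-family of discs, tangent
at `w + v` to the member `B̄(x, ρ)`; every loop of the sub-family's tied band below the hugging ring
surrounds that member. -/
theorem measure_exists_loop_gate_disc_le : ∀ E ∈ latticeEnsembles, ∃ c C c₀ : ℝ,
    0 < c ∧ 0 < C ∧ 0 < c₀ ∧ ∀ (w v x : ℂ) (ρ η δ : ℝ), 0 < δ → c₀ * δ ≤ η * ‖v‖ → η * ‖v‖ ≤ ρ →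
      w + v ∈ closedBall x ρ →
      E.P {ω | ∃ u ∈ (E.X δ ω).loops, closedBall x ρ ⊆ {z | u.wind z ≠ 0} ∧
        u.range ⊆ ball w ((1 + η) * ‖v‖)} ≤ ENNReal.ofReal (C * (η * ‖v‖ / ρ) ^ c) := by
  intro E hE
  obtain ⟨c, C, c₀, hc, hC, hc₀, hbd⟩ := measure_exists_loop_cross_le_latticeEnsembles E hE
  refine ⟨c, C, 2 * c₀, hc, hC, by positivity, fun w v x ρ η δ hδ hηv hηρ hvx ↦ ?_⟩
  obtain ⟨hη, hv⟩ := pos_of_mul_norm_pos (lt_of_lt_of_le (by positivity) hηv)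
  have hρ : 0 < ρ := lt_of_lt_of_le (mul_pos hη hv) hηρ
  set p : ℂ := w + ((1 + η / 2 : ℝ) : ℂ) * v with hp
  have hsub : {ω | ∃ u ∈ (E.X δ ω).loops, closedBall x ρ ⊆ {z | u.wind z ≠ 0} ∧
      u.range ⊆ ball w ((1 + η) * ‖v‖)} ⊆
      {ω | ∃ u ∈ (E.X δ ω).loops, (u.range ∩ closedBall p (η / 2 * ‖v‖)).Nonempty ∧
        (u.range ∩ (ball p (ρ / 2))ᶜ).Nonempty} := by
    rintro ω ⟨u, hu, hx, hr⟩
    exact ⟨u, hu, nonempty_range_inter_gate u hη.le (hx hvx) hr,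
      nonempty_range_inter_compl_ball_of_disc u hη.le hηρ hx hr⟩
  calc E.P _ ≤ E.P _ := measure_mono hsub
    _ ≤ ENNReal.ofReal (C * (η / 2 * ‖v‖ / (ρ / 2)) ^ c) :=
        hbd p (η / 2 * ‖v‖) (ρ / 2) δ hδ (by linarith) (by positivity)
    _ = ENNReal.ofReal (C * (η * ‖v‖ / ρ) ^ c) := by
        rw [show η / 2 * ‖v‖ / (ρ / 2) = η * ‖v‖ / ρ by field_simp]

end FusionSqueeze

/-! ## §3 The hugging-loop bound on both lattice ensembles (registered anchor) -/

/-- **Tight hugging loops are rare on both lattice ensembles** (registered helper toward stub R5'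
`stub_fusionTilt`, line `ring-cloud-tomography` r5; the RSW core of the `η`-squeeze).  For
`E ∈ latticeEnsembles` there are constants `c, C, c₀ > 0` such that for every centre `z₀ : ℂ`, every
radius `r₀ > 0`, every `η` and every mesh `δ > 0` with `c₀ δ ≤ η r₀`,
`E.P {ω | some loop of X_δ(ω) surrounds B̄(z₀, r₀) and has its trace inside B(z₀, (1 + η) r₀)} ≤ C η^c`:
such a loop winds around `z₀ ± r₀`, so it crosses the gate `B̄(z₀ + (1 + η/2) r₀, η r₀/2)` and leaves
`B(z₀ + (1 + η/2) r₀, 2 r₀)` (§1), a gap crossing of ratio `η/4`, rare by the landed two-arm bound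
`measure_exists_loop_cross_le_latticeEnsembles` (RSW on `δℤ²` and on `δ𝕋`).  No measurability of the
loop event is needed (outer measure). -/
theorem measure_exists_huggingLoop_le_latticeEnsembles : ∀ E ∈ latticeEnsembles, ∃ c C c₀ : ℝ,
    0 < c ∧ 0 < C ∧ 0 < c₀ ∧ ∀ (z₀ : ℂ) (r₀ η δ : ℝ), 0 < δ → 0 < r₀ → c₀ * δ ≤ η * r₀ →
      E.P {ω | ∃ u ∈ (E.X δ ω).loops, Metric.closedBall z₀ r₀ ⊆ {z | u.wind z ≠ 0} ∧
        u.range ⊆ Metric.ball z₀ ((1 + η) * r₀)} ≤ ENNReal.ofReal (C * η ^ c) := by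
  intro E hE
  obtain ⟨c, C, c₀, hc, hC, hc₀, hbd⟩ := FusionSqueeze.measure_exists_loop_antipodes_le E hE
  refine ⟨c, C, c₀, hc, hC, hc₀, fun z₀ r₀ η δ hδ hr₀ hη ↦ ?_⟩
  have hnorm : ‖((r₀ : ℝ) : ℂ)‖ = r₀ := by
    rw [Complex.norm_real, Real.norm_eq_abs, abs_of_pos hr₀]
  refine le_trans (measure_mono ?_) (hbd z₀ (r₀ : ℂ) η δ hδ (by rwa [hnorm]))
  rintro ω ⟨u, hu, hD, hr⟩
  refine ⟨u, hu, hD ?_, hD ?_, by rwa [hnorm]⟩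
  · rw [mem_closedBall, dist_eq_norm, add_sub_cancel_left, hnorm]
  · rw [mem_closedBall, dist_eq_norm, sub_sub_cancel_left, norm_neg, hnorm]

/-! ## §4 Tied bands of disc families; pattern counts and tilts in a hugging window -/

namespace FusionSqueeze

/-- **Tied bands are rare** (both lattices).  For `E ∈ latticeEnsembles` there are `c, C, c₀ > 0`
such that: for every disc family `B̄(z k, r k)`, every pattern `S` and two of its indices `i, j`
(possibly equal), every hugging ball `B(w, (1+η)‖v‖)` whose antipodal gate points `w + v`, `w − v` lie
in `B̄(z i, r i)` and `B̄(z j, r j)` respectively, and every mesh `δ > 0` with `c₀ δ ≤ η‖v‖`, the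
probability that SOME loop of `X_δ` surrounds every disc of `S` with trace inside the hugging ball is
at most `C η^c`.  (Two disjoint discs in their circumscribed disc `B̄(w, ‖v‖)` touch it at antipodal
points: the fusion "tied band below the hugging ring".) -/
theorem measure_exists_tiedLoop_le : ∀ E ∈ latticeEnsembles, ∃ c C c₀ : ℝ,
    0 < c ∧ 0 < C ∧ 0 < c₀ ∧ ∀ {n : ℕ} (z : Fin n → ℂ) (r : Fin n → ℝ) (S : Finset (Fin n))
      (i j : Fin n) (w v : ℂ) (η δ : ℝ), i ∈ S → j ∈ S → w + v ∈ closedBall (z i) (r i) →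
      w - v ∈ closedBall (z j) (r j) → 0 < δ → c₀ * δ ≤ η * ‖v‖ →
      E.P {ω | ∃ u ∈ (E.X δ ω).loops, (∀ k ∈ S, closedBall (z k) (r k) ⊆ {x | u.wind x ≠ 0}) ∧
        u.range ⊆ ball w ((1 + η) * ‖v‖)} ≤ ENNReal.ofReal (C * η ^ c) := by
  intro E hE
  obtain ⟨c, C, c₀, hc, hC, hc₀, hbd⟩ := measure_exists_loop_antipodes_le E hE
  refine ⟨c, C, c₀, hc, hC, hc₀, fun z r S i j w v η δ hi hj hvi hvj hδ hη ↦
    le_trans (measure_mono ?_) (hbd w v η δ hδ hη)⟩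
  rintro ω ⟨u, hu, hS, hr⟩
  exact ⟨u, hu, hS i hi hvi, hS j hj hvj, hr⟩

/-- **In a hugging window the tied pattern counts vanish with probability `1 − O(η^c)`** (both
lattices).  If the antipodal gate points `v`, `−v` of the window `B(0, (1+η)‖v‖)` lie in the discs
`B̄(z i, r i)`, `B̄(z j, r j)` of the family, then for every pattern `S ∋ i, j` and every mesh `δ > 0`
with `c₀ δ ≤ η‖v‖`, `E.P {N_S ≠ 0} ≤ C η^c`, `N_S = patternCount (E.X δ ·) z r ((1+η)‖v‖) S`:
a counted loop is a tied loop of §4. -/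
theorem measure_patternCount_ne_zero_le : ∀ E ∈ latticeEnsembles, ∃ c C c₀ : ℝ,
    0 < c ∧ 0 < C ∧ 0 < c₀ ∧ ∀ {n : ℕ} (z : Fin n → ℂ) (r : Fin n → ℝ) (S : Finset (Fin n))
      (i j : Fin n) (v : ℂ) (η δ : ℝ), i ∈ S → j ∈ S → v ∈ closedBall (z i) (r i) →
      -v ∈ closedBall (z j) (r j) → 0 < δ → c₀ * δ ≤ η * ‖v‖ →
      E.P {ω | patternCount (E.X δ ω) z r ((1 + η) * ‖v‖) S ≠ 0} ≤ ENNReal.ofReal (C * η ^ c) := by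
  intro E hE
  obtain ⟨c, C, c₀, hc, hC, hc₀, hbd⟩ := measure_exists_tiedLoop_le E hE
  refine ⟨c, C, c₀, hc, hC, hc₀, fun z r S i j v η δ hi hj hvi hvj hδ hη ↦
    le_trans (measure_mono ?_)
      (hbd z r S i j 0 v η δ hi hj (by rwa [zero_add]) (by rwa [zero_sub]) hδ hη)⟩
  intro ω hω
  obtain ⟨u, hu, hr, hin, -⟩ := Set.nonempty_of_ncard_ne_zero hω
  exact ⟨u, hu, hin, hr⟩

/-- The tilted pattern integrand with weights in `[0, 1]` takes values in `[0, 1]`. -/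
theorem prod_pow_patternCount_mem_Icc {n : ℕ} (c : LoopConfig ℂ) (z : Fin n → ℂ) (r : Fin n → ℝ)
    (R : ℝ) {u : Finset (Fin n) → ℝ} (hu0 : ∀ S, 0 ≤ u S) (hu1 : ∀ S, u S ≤ 1) :
    ∏ S ∈ nonemptyParts n, u S ^ patternCount c z r R S ∈ Set.Icc (0 : ℝ) 1 :=
  ⟨Finset.prod_nonneg fun S _ ↦ pow_nonneg (hu0 S) _,
    Finset.prod_le_one (fun S _ ↦ pow_nonneg (hu0 S) _) fun S _ ↦ pow_le_one₀ (hu0 S) (hu1 S)⟩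

/-- **The hugged tilt is blind to the tied weights, uniformly in the mesh** (both lattices).  For
`E ∈ latticeEnsembles` there are `c, C, c₀ > 0` such that: if the antipodal gate points `v`, `−v` of
the window `B(0, (1+η)‖v‖)` lie in the discs `B̄(z i, r i)`, `B̄(z j, r j)`, then for every mesh
`δ > 0` with `c₀ δ ≤ η‖v‖` and all weight vectors `u, u'` with entries in `[0, 1]` that agree on every
pattern NOT containing both `i` and `j`,
`|tilt E z r ((1+η)‖v‖) u δ − tilt E z r ((1+η)‖v‖) u' δ| ≤ C η^c`:
off the tied-loop event of §4 every tied count `N_S`, `S ∋ i, j`, vanishes and the two integrands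
coincide; on it they differ by at most `1`. -/
theorem abs_tilt_sub_tilt_le_of_gates : ∀ E ∈ latticeEnsembles, ∃ c C c₀ : ℝ,
    0 < c ∧ 0 < C ∧ 0 < c₀ ∧ ∀ {n : ℕ} (z : Fin n → ℂ) (r : Fin n → ℝ) (i j : Fin n) (v : ℂ)
      (η δ : ℝ) (u u' : Finset (Fin n) → ℝ), v ∈ closedBall (z i) (r i) →
      -v ∈ closedBall (z j) (r j) → 0 < δ → c₀ * δ ≤ η * ‖v‖ →
      (∀ S, 0 ≤ u S) → (∀ S, u S ≤ 1) → (∀ S, 0 ≤ u' S) → (∀ S, u' S ≤ 1) →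
      (∀ S, ¬ (i ∈ S ∧ j ∈ S) → u S = u' S) →
      |tilt E z r ((1 + η) * ‖v‖) u δ - tilt E z r ((1 + η) * ‖v‖) u' δ| ≤ C * η ^ c := by
  intro E hE
  haveI := isProbabilityMeasure_of_mem hE
  obtain ⟨c, C, c₀, hc, hC, hc₀, hbd⟩ := measure_exists_loop_antipodes_le E hE
  refine ⟨c, C, c₀, hc, hC, hc₀,
    fun {n} z r i j v η δ u u' hvi hvj hδ hη hu0 hu1 hu0' hu1' huu' ↦ ?_⟩
  obtain ⟨hηpos, -⟩ := pos_of_mul_norm_pos (lt_of_lt_of_le (by positivity) hη)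
  set R : ℝ := (1 + η) * ‖v‖ with hR
  -- the tied-loop event and its measurable hull
  set B : Set E.Ω := {ω | ∃ u ∈ (E.X δ ω).loops, u.wind (0 + v) ≠ 0 ∧ u.wind (0 - v) ≠ 0 ∧
    u.range ⊆ ball 0 ((1 + η) * ‖v‖)} with hB
  have hPB : E.P B ≤ ENNReal.ofReal (C * η ^ c) := hbd 0 v η δ hδ hη
  set F : E.Ω → ℝ := fun ω ↦ ∏ S ∈ nonemptyParts n, u S ^ patternCount (E.X δ ω) z r R S with hF
  set G : E.Ω → ℝ := fun ω ↦ ∏ S ∈ nonemptyParts n, u' S ^ patternCount (E.X δ ω) z r R S with hG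
  -- off the event the integrands coincide
  have hFG : ∀ ω, ω ∉ B → F ω = G ω := by
    intro ω hω
    refine Finset.prod_congr rfl fun S _ ↦ ?_
    by_cases hij : i ∈ S ∧ j ∈ S
    · have h0 : patternCount (E.X δ ω) z r R S = 0 := by
        by_contra hne
        obtain ⟨w, hw, hr, hin, -⟩ := Set.nonempty_of_ncard_ne_zero hne
        exact hω ⟨w, hw, by rw [zero_add]; exact hin i hij.1 hvi,
          by rw [zero_sub]; exact hin j hij.2 hvj, hr⟩
      rw [h0, pow_zero, pow_zero]
    · rw [huu' S hij]
  -- pointwise domination by the indicator of the measurable hull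
  set g : E.Ω → ℝ := (toMeasurable E.P B).indicator 1 with hg
  have hdom : ∀ ω, ‖F ω - G ω‖ ≤ g ω := by
    intro ω
    by_cases hω : ω ∈ B
    · have hg1 : g ω = 1 := by
        rw [hg, Set.indicator_of_mem (subset_toMeasurable E.P B hω), Pi.one_apply]
      rw [hg1, Real.norm_eq_abs]
      have h1 := prod_pow_patternCount_mem_Icc (E.X δ ω) z r R hu0 hu1
      have h2 := prod_pow_patternCount_mem_Icc (E.X δ ω) z r R hu0' hu1'
      rw [abs_sub_le_iff]
      constructor <;> [linarith [h1.2, h2.1]; linarith [h1.1, h2.2]]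
    · rw [hFG ω hω, sub_self, norm_zero]
      exact Set.indicator_nonneg (fun _ _ ↦ zero_le_one) ω
  have hgi : Integrable g E.P := (integrable_const (1 : ℝ)).indicator (measurableSet_toMeasurable E.P B)
  have hFi : Integrable F E.P := FusionCloud.integrable_prod_pow_patternCount E hE hδ z r R u hu0
  have hGi : Integrable G E.P := FusionCloud.integrable_prod_pow_patternCount E hE hδ z r R u' hu0'
  calc |tilt E z r R u δ - tilt E z r R u' δ| = ‖∫ ω, (F ω - G ω) ∂E.P‖ := by
        rw [Real.norm_eq_abs, integral_sub hFi hGi]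
        rfl
    _ ≤ ∫ ω, g ω ∂E.P := norm_integral_le_of_norm_le hgi (Eventually.of_forall hdom)
    _ = (E.P B).toReal := by
        rw [hg, integral_indicator_one (measurableSet_toMeasurable E.P B), measureReal_def,
          measure_toMeasurable]
    _ ≤ C * η ^ c := ENNReal.toReal_le_of_le_ofReal (by positivity) hPB

end FusionSqueeze

end Summit.CriticalPhenomena.CardyFormulaZ2.Cruxes.NestingRigidity.RingCloudTomography

end
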